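import Summits.QuantumFields.QCD.Theorems.QuarksAsStableActionStableActionBridgeStubBondKernelContinuous
import Summits.QuantumFields.QCD.Theorems.QuarksAsStableActionStableActionBridgeStubBondKernelStar

/-!
# Regularity of the gauge-averaged symmetric transfer kernel of lattice QCD
(helper for crux stmt-QuantumFields-8892 `HeatSlicedQuarks.RobustYangMillsHandover`, line
`pin-the-infimum` — registered stub `stub_symKernel_regular`, M1 / T1 of the Lüscher trace formula)

Smit's transfer matrix `T̂ = T̂_F^{1/2} T̂_U T̂_F^{1/2}` (Smit, *Introduction to Quantum Fields on a
Lattice*, §6.5 (6.87)) composed with the Gauss-law projector `P̂₀` (§4.6 (4.127)–(4.137)) is the scalar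
integral operator on `L²(SU(3)^{links} × J)` (`J ≃ Finset (SliceFermiIdx N_f S)` the Fock index) with
the **gauge-averaged symmetric kernel**

  `k_sym((U, s), (U', s')) = ∫ dg K_β(U, U'^g) [R(U) Γ(G_g) R(U')]_{s s'}`,

`dg` the product Haar probability measure of the compact group `𝒢 = SU(3)^{sites}` of time-independent
gauge transformations, `K_β = gaugeSliceKernel β` Wilson's gauge kernel, `Γ(G_g) = fockGaugeAct g` the
unitary Fock-space gauge action and `R` a continuous Hermitian matrix field (the square root of `T̂_F`).
We prove the three inputs of the abstract bounded-Hermitian-kernel package: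

* `uncurry k_sym` is strongly measurable: for each of the countably many index pairs it is the
  parametric integral over the compact group of a jointly continuous integrand, hence continuous in
  `(U, U')` (`continuous_parametric_integral_of_continuous`, `measurable_from_prod_countable_left`);
* a uniform bound `‖k_sym‖ ≤ C`: the entry sum of the integrand is continuous on the compact
  `X × X × 𝒢`, and `dg` is a probability measure (`norm_integral_le_of_norm_le_const`);
* Hermitian symmetry `k_sym(p, q) = conj k_sym(q, p)`: `conj ∫ = ∫ conj` (`integral_conj`),
  `[R(U')Γ_gR(U)]ᴴ = R(U)Γ_gᴴR(U')` with `Γ_gᴴ = Γ_{g⁻¹}` (`StubBondKernelStar.fockGaugeAct_conjTranspose`),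
  `K_β(U', U^g) = K_β(U, U'^{g⁻¹})` (`StubBondKernelStar.gaugeSliceKernel_gaugeTransform_inv`:
  symmetry + joint gauge invariance of the kernel), and the substitution `g ↦ g⁻¹`
  (`integral_inv_eq_self`: the Haar probability measure of a compact group is inversion invariant,
  `Measure.pi.isInvInvariant` with the tree's `haarProbability.instIsInvInvariant`).

References: J. Smit, *Introduction to Quantum Fields on a Lattice*, §4.6 (4.127)–(4.137), §6.5 (6.87)
[Smit2023]; M. Lüscher, Commun. Math. Phys. 54 (1977) 283 [Luscher1977, pp. 283–292].  Pure theorem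
file; reusable pieces in the sub-namespace `StubSymKernelRegular`.
-/

noncomputable section

namespace Summit.QuantumFields.QCD.Cruxes.RobustYangMillsHandover.PinTheInfimum

open MeasureTheory Filter Function Matrix
open Literature.MathematicalPhysics.QuantumFieldTheory Literature.MathematicalPhysics.QuantumLattice
open Literature.Probability.LatticeModels
open Summit.QuantumFields.QCD.Cruxes.StableActionBridge.TwistedTraceTransfer
  (StubBondKernelContinuous.continuous_fockGaugeAct
    StubBondKernelContinuous.continuous_gaugeSliceKernel_gaugeTransform
    StubBondKernelStar.fockGaugeAct_conjTranspose
    StubBondKernelStar.gaugeSliceKernel_gaugeTransform_inv)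

namespace StubSymKernelRegular

variable {Nf S : ℕ} [NeZero S]

/-! ### The integrand `((U, U'), g) ↦ K_β(U, U'^g) [R(U) Γ(G_g) R(U')]_{s t}` -/

/-- **Joint continuity of the averaging integrand** `((U, U'), g) ↦ K_β(U, U'^g) [R(U) Γ(G_g) R(U')]_{s t}`
on `(SU(3)^E × SU(3)^E) × SU(3)^{sites}` for a continuous matrix field `R`. [folklore] -/
theorem continuous_symIntegrand (β : ℝ)
    {R : GaugeConfig 3 S (Matrix.specialUnitaryGroup (Fin 3) ℂ) →
      Matrix (Finset (SliceFermiIdx Nf S)) (Finset (SliceFermiIdx Nf S)) ℂ}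
    (hR : Continuous R) (s t : Finset (SliceFermiIdx Nf S)) :
    Continuous fun z : (GaugeConfig 3 S (Matrix.specialUnitaryGroup (Fin 3) ℂ) ×
        GaugeConfig 3 S (Matrix.specialUnitaryGroup (Fin 3) ℂ)) ×
          (TorusSite 3 S → Matrix.specialUnitaryGroup (Fin 3) ℂ) =>
      (gaugeSliceKernel β z.1.1 (gaugeTransform z.2 z.1.2) : ℂ) *
        (R z.1.1 * fockGaugeAct (Nf := Nf) (S := S) z.2 * R z.1.2) s t := by
  have hK := Complex.continuous_ofReal.comp
    (StubBondKernelContinuous.continuous_gaugeSliceKernel_gaugeTransform (S := S) β)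
  have hΓ := (StubBondKernelContinuous.continuous_fockGaugeAct (Nf := Nf) (S := S)).comp
    (continuous_snd :
      Continuous fun z : (GaugeConfig 3 S (Matrix.specialUnitaryGroup (Fin 3) ℂ) ×
        GaugeConfig 3 S (Matrix.specialUnitaryGroup (Fin 3) ℂ)) ×
          (TorusSite 3 S → Matrix.specialUnitaryGroup (Fin 3) ℂ) => z.2)
  have h1 := hR.comp (continuous_fst.comp
    (continuous_fst :
      Continuous fun z : (GaugeConfig 3 S (Matrix.specialUnitaryGroup (Fin 3) ℂ) ×
        GaugeConfig 3 S (Matrix.specialUnitaryGroup (Fin 3) ℂ)) ×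
          (TorusSite 3 S → Matrix.specialUnitaryGroup (Fin 3) ℂ) => z.1))
  have h2 := hR.comp (continuous_snd.comp
    (continuous_fst :
      Continuous fun z : (GaugeConfig 3 S (Matrix.specialUnitaryGroup (Fin 3) ℂ) ×
        GaugeConfig 3 S (Matrix.specialUnitaryGroup (Fin 3) ℂ)) ×
          (TorusSite 3 S → Matrix.specialUnitaryGroup (Fin 3) ℂ) => z.1))
  exact hK.mul (((h1.matrix_mul hΓ).matrix_mul h2).matrix_elem s t)

/-- **Continuity of the averaged kernel entry** `(U, U') ↦ ∫ dg K_β(U, U'^g) [R(U) Γ(G_g) R(U')]_{s t}`: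
a parametric integral of a jointly continuous integrand over the compact group `SU(3)^{sites}` with its
product Haar probability measure. [cite: Smit2023, §4.6 (4.127)–(4.137)] -/
theorem continuous_symEntry (β : ℝ)
    {R : GaugeConfig 3 S (Matrix.specialUnitaryGroup (Fin 3) ℂ) →
      Matrix (Finset (SliceFermiIdx Nf S)) (Finset (SliceFermiIdx Nf S)) ℂ}
    (hR : Continuous R) (s t : Finset (SliceFermiIdx Nf S)) :
    Continuous fun x : GaugeConfig 3 S (Matrix.specialUnitaryGroup (Fin 3) ℂ) ×
        GaugeConfig 3 S (Matrix.specialUnitaryGroup (Fin 3) ℂ) =>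
      ∫ g, (gaugeSliceKernel β x.1 (gaugeTransform g x.2) : ℂ) *
          (R x.1 * fockGaugeAct (Nf := Nf) (S := S) g * R x.2) s t
        ∂(Measure.pi fun _ : TorusSite 3 S => haarProbability (Matrix.specialUnitaryGroup (Fin 3) ℂ)) := by
  have h := continuous_parametric_integral_of_continuous
    (μ := Measure.pi fun _ : TorusSite 3 S => haarProbability (Matrix.specialUnitaryGroup (Fin 3) ℂ))
    (f := fun (x : GaugeConfig 3 S (Matrix.specialUnitaryGroup (Fin 3) ℂ) ×
          GaugeConfig 3 S (Matrix.specialUnitaryGroup (Fin 3) ℂ))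
        (g : TorusSite 3 S → Matrix.specialUnitaryGroup (Fin 3) ℂ) =>
      (gaugeSliceKernel β x.1 (gaugeTransform g x.2) : ℂ) *
        (R x.1 * fockGaugeAct (Nf := Nf) (S := S) g * R x.2) s t)
    (continuous_symIntegrand β hR s t) isCompact_univ
  simpa only [Measure.restrict_univ] using h

/-- The entry sum `∑_{s,t} ‖K_β(U, U'^g) [R(U) Γ(G_g) R(U')]_{s t}‖` of the integrand is continuous on the
compact `(SU(3)^E × SU(3)^E) × SU(3)^{sites}`, hence uniformly bounded. [folklore] -/
theorem exists_bound_symIntegrand_sum (β : ℝ)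
    {R : GaugeConfig 3 S (Matrix.specialUnitaryGroup (Fin 3) ℂ) →
      Matrix (Finset (SliceFermiIdx Nf S)) (Finset (SliceFermiIdx Nf S)) ℂ}
    (hR : Continuous R) :
    ∃ C : ℝ, ∀ (U U' : GaugeConfig 3 S (Matrix.specialUnitaryGroup (Fin 3) ℂ))
      (g : TorusSite 3 S → Matrix.specialUnitaryGroup (Fin 3) ℂ),
      ∑ s, ∑ t, ‖(gaugeSliceKernel β U (gaugeTransform g U') : ℂ) *
        (R U * fockGaugeAct (Nf := Nf) (S := S) g * R U') s t‖ ≤ C := by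
  have hc : Continuous fun z : (GaugeConfig 3 S (Matrix.specialUnitaryGroup (Fin 3) ℂ) ×
      GaugeConfig 3 S (Matrix.specialUnitaryGroup (Fin 3) ℂ)) ×
        (TorusSite 3 S → Matrix.specialUnitaryGroup (Fin 3) ℂ) =>
      ∑ s, ∑ t, ‖(gaugeSliceKernel β z.1.1 (gaugeTransform z.2 z.1.2) : ℂ) *
        (R z.1.1 * fockGaugeAct (Nf := Nf) (S := S) z.2 * R z.1.2) s t‖ :=
    continuous_finsetSum _ fun s _ => continuous_finsetSum _ fun t _ =>
      (continuous_symIntegrand β hR s t).norm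
  obtain ⟨C, hC⟩ := isCompact_univ.exists_bound_of_continuousOn hc.continuousOn
  exact ⟨C, fun U U' g => (Real.le_norm_self _).trans (hC ((U, U'), g) (Set.mem_univ _))⟩

/-- **Uniform bound on the averaged kernel**: `‖∫ dg K_β(U, U'^g) [R(U) Γ(G_g) R(U')]_{s t}‖ ≤ C`, one
entry being dominated by the bounded entry sum and `dg` being a probability measure. [folklore] -/
theorem exists_bound_symEntry (β : ℝ)
    {R : GaugeConfig 3 S (Matrix.specialUnitaryGroup (Fin 3) ℂ) →
      Matrix (Finset (SliceFermiIdx Nf S)) (Finset (SliceFermiIdx Nf S)) ℂ}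
    (hR : Continuous R) :
    ∃ C : ℝ, ∀ (U U' : GaugeConfig 3 S (Matrix.specialUnitaryGroup (Fin 3) ℂ))
      (s t : Finset (SliceFermiIdx Nf S)),
      ‖∫ g, (gaugeSliceKernel β U (gaugeTransform g U') : ℂ) *
          (R U * fockGaugeAct (Nf := Nf) (S := S) g * R U') s t
        ∂(Measure.pi fun _ : TorusSite 3 S => haarProbability (Matrix.specialUnitaryGroup (Fin 3) ℂ))‖ ≤ C := by
  obtain ⟨C, hC⟩ := exists_bound_symIntegrand_sum (Nf := Nf) (S := S) β hR
  refine ⟨C, fun U U' s t => ?_⟩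
  have hpt : ∀ g : TorusSite 3 S → Matrix.specialUnitaryGroup (Fin 3) ℂ,
      ‖(gaugeSliceKernel β U (gaugeTransform g U') : ℂ) *
        (R U * fockGaugeAct (Nf := Nf) (S := S) g * R U') s t‖ ≤ C := fun g =>
    calc ‖(gaugeSliceKernel β U (gaugeTransform g U') : ℂ) *
          (R U * fockGaugeAct (Nf := Nf) (S := S) g * R U') s t‖
        ≤ ∑ t', ‖(gaugeSliceKernel β U (gaugeTransform g U') : ℂ) *
            (R U * fockGaugeAct (Nf := Nf) (S := S) g * R U') s t'‖ :=
          Finset.single_le_sum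
            (f := fun t' => ‖(gaugeSliceKernel β U (gaugeTransform g U') : ℂ) *
              (R U * fockGaugeAct (Nf := Nf) (S := S) g * R U') s t'‖)
            (fun _ _ => norm_nonneg _) (Finset.mem_univ t)
      _ ≤ ∑ s', ∑ t', ‖(gaugeSliceKernel β U (gaugeTransform g U') : ℂ) *
            (R U * fockGaugeAct (Nf := Nf) (S := S) g * R U') s' t'‖ :=
          Finset.single_le_sum
            (f := fun s' => ∑ t', ‖(gaugeSliceKernel β U (gaugeTransform g U') : ℂ) *
              (R U * fockGaugeAct (Nf := Nf) (S := S) g * R U') s' t'‖)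
            (fun _ _ => Finset.sum_nonneg fun _ _ => norm_nonneg _) (Finset.mem_univ s)
      _ ≤ C := hC U U' g
  have h := norm_integral_le_of_norm_le_const
    (μ := Measure.pi fun _ : TorusSite 3 S => haarProbability (Matrix.specialUnitaryGroup (Fin 3) ℂ))
    (Eventually.of_forall hpt)
  rwa [probReal_univ, mul_one] at h

/-! ### Hermitian symmetry: `conj`, `Γ(G_g)ᴴ = Γ(G_{g⁻¹})`, `K_β(U', U^g) = K_β(U, U'^{g⁻¹})`, `g ↦ g⁻¹` -/

/-- **Pointwise Hermitian symmetry of the integrand**: for Hermitian `R`,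
`conj (K_β(U', U^g) [R(U') Γ(G_g) R(U)]_{t s}) = K_β(U, U'^{g⁻¹}) [R(U) Γ(G_{g⁻¹}) R(U')]_{s t}`
(`K_β` is real, `Mᴴ_{s t} = conj M_{t s}`, `(R' Γ_g R)ᴴ = R Γ_gᴴ R'`, `Γ_gᴴ = Γ_{g⁻¹}`,
`K_β(U', U^g) = K_β(U, U'^{g⁻¹})`). [cite: Smit2023, §6.5 (6.87)] -/
theorem symIntegrand_conj (β : ℝ)
    {R : GaugeConfig 3 S (Matrix.specialUnitaryGroup (Fin 3) ℂ) →
      Matrix (Finset (SliceFermiIdx Nf S)) (Finset (SliceFermiIdx Nf S)) ℂ}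
    (hH : ∀ U, (R U)ᴴ = R U) (g : TorusSite 3 S → Matrix.specialUnitaryGroup (Fin 3) ℂ)
    (U U' : GaugeConfig 3 S (Matrix.specialUnitaryGroup (Fin 3) ℂ)) (s t : Finset (SliceFermiIdx Nf S)) :
    (starRingEnd ℂ) ((gaugeSliceKernel β U' (gaugeTransform g U) : ℂ) *
        (R U' * fockGaugeAct (Nf := Nf) (S := S) g * R U) t s) =
      (gaugeSliceKernel β U (gaugeTransform g⁻¹ U') : ℂ) *
        (R U * fockGaugeAct (Nf := Nf) (S := S) g⁻¹ * R U') s t := by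
  rw [map_mul, Complex.conj_ofReal, starRingEnd_apply, ← Matrix.conjTranspose_apply,
    Matrix.conjTranspose_mul, Matrix.conjTranspose_mul, hH, hH,
    StubBondKernelStar.fockGaugeAct_conjTranspose, ← Matrix.mul_assoc,
    StubBondKernelStar.gaugeSliceKernel_gaugeTransform_inv]

/-- **Hermitian symmetry of the averaged kernel**:
`∫ dg K_β(U, U'^g) [R(U)Γ_gR(U')]_{s t} = conj ∫ dg K_β(U', U^g) [R(U')Γ_gR(U)]_{t s}` — pull `conj`
inside (`integral_conj`), use the pointwise identity `symIntegrand_conj`, and substitute `g ↦ g⁻¹`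
(inversion invariance of the Haar probability measure of the compact group `SU(3)^{sites}`).
[cite: Smit2023, §6.5 (6.87)] -/
theorem symEntry_conj (β : ℝ)
    {R : GaugeConfig 3 S (Matrix.specialUnitaryGroup (Fin 3) ℂ) →
      Matrix (Finset (SliceFermiIdx Nf S)) (Finset (SliceFermiIdx Nf S)) ℂ}
    (hH : ∀ U, (R U)ᴴ = R U) (U U' : GaugeConfig 3 S (Matrix.specialUnitaryGroup (Fin 3) ℂ))
    (s t : Finset (SliceFermiIdx Nf S)) :
    ∫ g, (gaugeSliceKernel β U (gaugeTransform g U') : ℂ) *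
          (R U * fockGaugeAct (Nf := Nf) (S := S) g * R U') s t
        ∂(Measure.pi fun _ : TorusSite 3 S => haarProbability (Matrix.specialUnitaryGroup (Fin 3) ℂ)) =
      (starRingEnd ℂ) (∫ g, (gaugeSliceKernel β U' (gaugeTransform g U) : ℂ) *
          (R U' * fockGaugeAct (Nf := Nf) (S := S) g * R U) t s
        ∂(Measure.pi fun _ : TorusSite 3 S => haarProbability (Matrix.specialUnitaryGroup (Fin 3) ℂ))) := by
  rw [← integral_conj]
  have h : (fun g : TorusSite 3 S → Matrix.specialUnitaryGroup (Fin 3) ℂ => (starRingEnd ℂ)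
      ((gaugeSliceKernel β U' (gaugeTransform g U) : ℂ) *
        (R U' * fockGaugeAct (Nf := Nf) (S := S) g * R U) t s)) =
      fun g => (gaugeSliceKernel β U (gaugeTransform g⁻¹ U') : ℂ) *
        (R U * fockGaugeAct (Nf := Nf) (S := S) g⁻¹ * R U') s t :=
    funext fun g => symIntegrand_conj β hH g U U' s t
  rw [h]
  exact (integral_inv_eq_self
    (fun g : TorusSite 3 S → Matrix.specialUnitaryGroup (Fin 3) ℂ =>
      (gaugeSliceKernel β U (gaugeTransform g U') : ℂ) *
        (R U * fockGaugeAct (Nf := Nf) (S := S) g * R U') s t)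
    (Measure.pi fun _ : TorusSite 3 S => haarProbability (Matrix.specialUnitaryGroup (Fin 3) ℂ))).symm

end StubSymKernelRegular

/-- **Stub `stub_symKernel_regular` of line `pin-the-infimum` (M1 / T1: regularity of the
gauge-averaged symmetric transfer kernel).**  For a continuous Hermitian matrix field `R` on the slice
configurations `SU(3)^{links}` and a finite measurable index type `J ≃ Finset (SliceFermiIdx N_f S)`,
the kernel `k_sym((U, s), (U', s')) = ∫ dg K_β(U, U'^g) [R(U) Γ(G_g) R(U')]_{e⁻¹s, e⁻¹s'}` (Haar average
over the time-independent gauge transformations `g : sites → SU(3)`) is (i) strongly measurable as a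
function on `(X × J)²`, (ii) uniformly bounded, and (iii) Hermitian, `k_sym(p, q) = conj k_sym(q, p)`:
the three inputs of the abstract Hermitian-kernel trace formula for `𝕋P̂₀ = P̂₀𝕋`.
[cite: Smit2023, §4.6 (4.127)–(4.137) and §6.5 (6.87)] -/
theorem stub_symKernel_regular :
    ∀ (Nf S : ℕ) [NeZero S] (β : ℝ) (J : Type) [Fintype J] [MeasurableSpace J] [MeasurableSingletonClass J]
      (e : Finset (SliceFermiIdx Nf S) ≃ J)
      (R : GaugeConfig 3 S (Matrix.specialUnitaryGroup (Fin 3) ℂ) →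
        Matrix (Finset (SliceFermiIdx Nf S)) (Finset (SliceFermiIdx Nf S)) ℂ),
      Continuous R → (∀ U, (R U)ᴴ = R U) →
      (StronglyMeasurable (uncurry fun (p q : GaugeConfig 3 S (Matrix.specialUnitaryGroup (Fin 3) ℂ) × J) =>
          ∫ g, (gaugeSliceKernel β p.1 (gaugeTransform g q.1) : ℂ) *
              (R p.1 * fockGaugeAct (Nf := Nf) (S := S) g * R q.1) (e.symm p.2) (e.symm q.2)
            ∂(Measure.pi fun _ : TorusSite 3 S => haarProbability (Matrix.specialUnitaryGroup (Fin 3) ℂ)))) ∧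
      (∃ C : ℝ, ∀ p q : GaugeConfig 3 S (Matrix.specialUnitaryGroup (Fin 3) ℂ) × J,
          ‖∫ g, (gaugeSliceKernel β p.1 (gaugeTransform g q.1) : ℂ) *
              (R p.1 * fockGaugeAct (Nf := Nf) (S := S) g * R q.1) (e.symm p.2) (e.symm q.2)
            ∂(Measure.pi fun _ : TorusSite 3 S => haarProbability (Matrix.specialUnitaryGroup (Fin 3) ℂ))‖ ≤ C) ∧
      ∀ p q : GaugeConfig 3 S (Matrix.specialUnitaryGroup (Fin 3) ℂ) × J,
        (∫ g, (gaugeSliceKernel β p.1 (gaugeTransform g q.1) : ℂ) *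
              (R p.1 * fockGaugeAct (Nf := Nf) (S := S) g * R q.1) (e.symm p.2) (e.symm q.2)
            ∂(Measure.pi fun _ : TorusSite 3 S => haarProbability (Matrix.specialUnitaryGroup (Fin 3) ℂ))) =
          (starRingEnd ℂ) (∫ g, (gaugeSliceKernel β q.1 (gaugeTransform g p.1) : ℂ) *
              (R q.1 * fockGaugeAct (Nf := Nf) (S := S) g * R p.1) (e.symm q.2) (e.symm p.2)
            ∂(Measure.pi fun _ : TorusSite 3 S => haarProbability (Matrix.specialUnitaryGroup (Fin 3) ℂ))) := by
  intro Nf S _ β J _ _ _ e R hR hH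
  refine ⟨?_, ?_, ?_⟩
  · -- (i) strong measurability: regroup as `(X × X) × (J × J)`, countable second factor
    have hg : Measurable fun w : (GaugeConfig 3 S (Matrix.specialUnitaryGroup (Fin 3) ℂ) ×
        GaugeConfig 3 S (Matrix.specialUnitaryGroup (Fin 3) ℂ)) × (J × J) =>
          ∫ g, (gaugeSliceKernel β w.1.1 (gaugeTransform g w.1.2) : ℂ) *
              (R w.1.1 * fockGaugeAct (Nf := Nf) (S := S) g * R w.1.2) (e.symm w.2.1) (e.symm w.2.2)
            ∂(Measure.pi fun _ : TorusSite 3 S =>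
              haarProbability (Matrix.specialUnitaryGroup (Fin 3) ℂ)) :=
      measurable_from_prod_countable_left fun st =>
        (StubSymKernelRegular.continuous_symEntry β hR (e.symm st.1) (e.symm st.2)).measurable
    have hm : Measurable fun z : (GaugeConfig 3 S (Matrix.specialUnitaryGroup (Fin 3) ℂ) × J) ×
        (GaugeConfig 3 S (Matrix.specialUnitaryGroup (Fin 3) ℂ) × J) =>
          ((z.1.1, z.2.1), (z.1.2, z.2.2)) :=
      (measurable_fst.fst.prodMk measurable_snd.fst).prodMk
        (measurable_fst.snd.prodMk measurable_snd.snd)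
    exact (hg.comp hm).stronglyMeasurable
  · -- (ii) uniform bound
    obtain ⟨C, hC⟩ := StubSymKernelRegular.exists_bound_symEntry (Nf := Nf) (S := S) β hR
    exact ⟨C, fun p q => hC p.1 q.1 (e.symm p.2) (e.symm q.2)⟩
  · -- (iii) Hermitian symmetry
    intro p q
    exact StubSymKernelRegular.symEntry_conj β hH p.1 q.1 (e.symm p.2) (e.symm q.2)

end Summit.QuantumFields.QCD.Cruxes.RobustYangMillsHandover.PinTheInfimum

end
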